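import Summits.AtomisticToContinuum.FouriersLaw.Theorems.HonestZwanzigNetworkReductionPackage

/-!
# HonestZwanzig / NetworkReduction — the limit `s ↓ 0` at fixed `N` and the `N → ∞` bookkeeping

Support file for item `stmt-AtomisticToContinuum-12701` (`NetworkReduction` of route `HonestZwanzig`,
sub-problem `FouriersLaw`).

* `tendsto_lap_totalCurrent`: `lap_s(J,J) → ∫₀^∞ corr(J,J)` as `s ↓ 0` (dominated convergence,
  `corr(J,J) ∈ L¹(0,∞)` from the `FeshbachIdentities` package).
* `fixedN_limit`: passing to the limit `s ↓ 0` in `fixedN_sandwich` along the orthogonal-dynamics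
  DC responses `ρ_b = lim schur_s(j_b,J)` and contact responses `w_y = lim schur_s(p_y²,J)` of
  `OrthogonalOhm`: `Σ_b ρ_b − c⁻¹(Σ_{b+1<N}(ρ_b − k)² + (γw₀ − k)² + (γw₁ + k)²) ≤ ∫₀^∞corr(J,J) ≤ Σ_b ρ_b`.
* `tendsto_div_of_linear_bound`, `card_nonbulk_le`, `sum_abs_le_of_bulk`: the elementary
  bookkeeping for `N → ∞` (at most `2R+1` bonds lie within distance `R` of an end).

Gadgets (`corr`, `lap`, `cov`, `e`, `G`, `schur`, `F`, `Adm`) are implicit variables with their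
defining equations as named hypotheses, instantiated by `rfl` in the closing file.
-/

noncomputable section

open MeasureTheory Finset Real Set Filter ProbabilityTheory Topology
open Literature.MathematicalPhysics.KineticTheory.HeatConduction

namespace Summit.AtomisticToContinuum.FouriersLaw.Theorems.HonestZwanzig.NetworkReduction

/-! ### The limit `s ↓ 0` at fixed `N` -/

section Limits

variable {ω₂ lam β γ : ℝ} {N : ℕ} {T : ℝ}
  {Adm : (PhaseSpace N → ℝ) → Prop}
  {corr : (PhaseSpace N → ℝ) → (PhaseSpace N → ℝ) → ℝ → ℝ}
  {lap : ℝ → (PhaseSpace N → ℝ) → (PhaseSpace N → ℝ) → ℝ}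
  {cov : (PhaseSpace N → ℝ) → (PhaseSpace N → ℝ) → ℝ}
  {e : Fin N → PhaseSpace N → ℝ}
  {G : ℝ → Matrix (Fin N) (Fin N) ℝ}
  {schur : ℝ → (PhaseSpace N → ℝ) → (PhaseSpace N → ℝ) → ℝ}
  {F : ℝ → Fin N → Fin N → ℝ}
  (hAdm : ∀ f, Adm f ↔ (Continuous f ∧ ∃ A : ℝ, ∀ z,
    |f z| ≤ A * Real.exp ((pinnedChain ω₂ lam β γ).hamiltonian N z / (8 * T))))
  (hcorr : ∀ f g t, corr f g t =
    (∫ z, f z * (∫ y, g y ∂((pinnedChain ω₂ lam β γ).transitionKernel N T T t.toNNReal z))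
      ∂(pinnedChain ω₂ lam β γ).gibbsMeasure N T) -
    (∫ z, f z ∂(pinnedChain ω₂ lam β γ).gibbsMeasure N T) *
      (∫ z, g z ∂(pinnedChain ω₂ lam β γ).gibbsMeasure N T))
  (hlap : ∀ s f g, lap s f g = ∫ t in Set.Ioi (0 : ℝ), Real.exp (-(s * t)) * corr f g t)
  (hcov : ∀ f g, cov f g = (∫ z, f z * g z ∂(pinnedChain ω₂ lam β γ).gibbsMeasure N T) -
    (∫ z, f z ∂(pinnedChain ω₂ lam β γ).gibbsMeasure N T) *
      (∫ z, g z ∂(pinnedChain ω₂ lam β γ).gibbsMeasure N T))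
  (he : ∀ x z, e x z = z.2 x ^ 2 / 2 + (pinnedChain ω₂ lam β γ).U (z.1 x) +
    ∑ j : Fin N, ((if j.val = x.val + 1 then (pinnedChain ω₂ lam β γ).V (z.1 j - z.1 x) / 2 else 0) +
      (if x.val = j.val + 1 then (pinnedChain ω₂ lam β γ).V (z.1 x - z.1 j) / 2 else 0)))
  (hG : ∀ s x y, G s x y = lap s (e x) (e y))
  (hschur : ∀ s f g, schur s f g = lap s f g - ∑ x, ∑ y, lap s f (e x) * (G s)⁻¹ x y * lap s (e y) g)
  (hF : ∀ s x y, F s x y = s * cov (e x) (e y) - cov (e x) ((pinnedChain ω₂ lam β γ).generator N T T (e y)) -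
      schur s (fun z => (pinnedChain ω₂ lam β γ).generator N T T (e x) (z.1, -z.2))
        ((pinnedChain ω₂ lam β γ).generator N T T (e y)))
  (hFI : ∀ f g : PhaseSpace N → ℝ, Adm f → Adm g →
    Integrable f ((pinnedChain ω₂ lam β γ).gibbsMeasure N T) ∧
    (∀ t : ℝ, 0 ≤ t → Integrable (fun z => f z *
      (∫ y, g y ∂((pinnedChain ω₂ lam β γ).transitionKernel N T T t.toNNReal z)))
      ((pinnedChain ω₂ lam β γ).gibbsMeasure N T)) ∧
    IntegrableOn (corr f g) (Set.Ioi 0) ∧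
    (∀ t : ℝ, 0 ≤ t → corr f g t = corr (fun z => g (z.1, -z.2)) (fun z => f (z.1, -z.2)) t) ∧
    (∀ s : ℝ, 0 < s → ∀ x : Fin N,
      s * lap s (e x) g - cov (e x) g =
        lap s (fun z => (pinnedChain ω₂ lam β γ).generator N T T (e x) (z.1, -z.2)) g ∧
      s * lap s f (e x) - cov f (e x) = lap s f ((pinnedChain ω₂ lam β γ).generator N T T (e x))))
  (hGSE : ∀ (x : Fin N) (z : PhaseSpace N), (pinnedChain ω₂ lam β γ).generator N T T (e x) z =
    (∑ b : Fin N, ((if x.val = b.val + 1 then (pinnedChain ω₂ lam β γ).bondCurrent N b z else 0) -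
      (if b = x then (pinnedChain ω₂ lam β γ).bondCurrent N b z else 0))) +
    (if x.val = 0 then (pinnedChain ω₂ lam β γ).γ * (T - z.2 x ^ 2) else 0) +
    (if x.val = N - 1 then (pinnedChain ω₂ lam β γ).γ * (T - z.2 x ^ 2) else 0))
  (hPS : ∀ x y : Fin N, cov (e x) ((pinnedChain ω₂ lam β γ).generator N T T (e y)) =
    -(if x = y ∧ (x.val = 0 ∨ x.val = N - 1) then (pinnedChain ω₂ lam β γ).γ * T ^ 2 else 0))
  (hω : 0 < ω₂) (hl : 0 ≤ lam) (hβ : 0 ≤ β) (hγ : 0 ≤ γ) (hT : 0 < T)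

include hAdm hlap hFI hω hl hβ hT in
/-- **`s ↓ 0` in the Laplace transform** (dominated convergence, `corr(J,J) ∈ L¹(0,∞)`):
`lap_s(J,J) → ∫₀^∞ corr(J,J)` as `s ↓ 0`. -/
theorem tendsto_lap_totalCurrent :
    Tendsto (fun s => lap s (fun z => ∑ i : Fin N, (pinnedChain ω₂ lam β γ).bondCurrent N i z)
        (fun z => ∑ i : Fin N, (pinnedChain ω₂ lam β γ).bondCurrent N i z))
      (nhdsWithin (0 : ℝ) (Set.Ioi 0))
      (nhds (∫ t in Set.Ioi (0 : ℝ), corr (fun z => ∑ i : Fin N, (pinnedChain ω₂ lam β γ).bondCurrent N i z)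
        (fun z => ∑ i : Fin N, (pinnedChain ω₂ lam β γ).bondCurrent N i z) t)) := by
  set J : PhaseSpace N → ℝ := fun z => ∑ i : Fin N, (pinnedChain ω₂ lam β γ).bondCurrent N i z with hJ
  have hJa : Adm J := adm_totalCurrent Adm hAdm hω hl hβ hT
  have hI : IntegrableOn (corr J J) (Set.Ioi 0) := (hFI J J hJa hJa).2.2.1
  have hfun : (fun s => lap s J J) = fun s => ∫ t in Set.Ioi (0 : ℝ), Real.exp (-(s * t)) * corr J J t :=
    funext fun s => hlap s J J
  rw [hfun]
  refine tendsto_integral_filter_of_dominated_convergence (fun t => ‖corr J J t‖) ?_ ?_ hI.norm ?_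
  · exact Eventually.of_forall fun s =>
      ((by fun_prop : Continuous fun t : ℝ => Real.exp (-(s * t))).aestronglyMeasurable).mul
        hI.aestronglyMeasurable
  · filter_upwards [self_mem_nhdsWithin] with s hs
    filter_upwards [ae_restrict_mem measurableSet_Ioi] with t ht
    rw [norm_mul, Real.norm_eq_abs, abs_of_pos (Real.exp_pos _)]
    have h1 : Real.exp (-(s * t)) ≤ 1 := by
      rw [← Real.exp_zero]
      exact Real.exp_le_exp.mpr (by nlinarith [mul_pos (show (0:ℝ) < s from hs) (show (0:ℝ) < t from ht)])
    calc Real.exp (-(s * t)) * ‖corr J J t‖ ≤ 1 * ‖corr J J t‖ :=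
        mul_le_mul_of_nonneg_right h1 (norm_nonneg _)
      _ = ‖corr J J t‖ := one_mul _
  · refine Eventually.of_forall fun t => ?_
    have hc : Continuous fun s : ℝ => Real.exp (-(s * t)) * corr J J t := by fun_prop
    have := (hc.tendsto 0).mono_left (nhdsWithin_le_nhds (s := Set.Ioi (0 : ℝ)))
    simpa using this

include hAdm hcorr hlap hcov he hG hschur hF hFI hGSE hPS hω hl hβ hγ hT in
/-- **The fixed-`N` two-sided bound in the limit `s ↓ 0`.** Given the orthogonal-dynamics DC responses
`ρ_b = lim_{s↓0} schur_s(j_b, J)` (`b+1 < N`), the two contact responses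
`w = lim_{s↓0} schur_s(p_y², J)` (`y ∈ {0, N−1}`), positive definite `Cov(e,e)` and `G(s)`, and Robin
coercivity of the Feshbach matrix with constant `c` for small `s`:
`Σ_b ρ_b − c⁻¹(Σ_b (ρ_b − k)² + (γw_0 − k)² + (γw_{N−1} + k)²) ≤ ∫₀^∞corr(J,J) ≤ Σ_b ρ_b`. -/
theorem fixedN_limit (hN : 2 ≤ N)
    (hCp : ∀ v : Fin N → ℝ, v ≠ 0 → 0 < ∑ x, ∑ y, v x * cov (e x) (e y) * v y)
    (hGp : ∀ s : ℝ, 0 < s → ∀ v : Fin N → ℝ, v ≠ 0 → 0 < ∑ x, ∑ y, v x * G s x y * v y)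
    {c s₀ : ℝ} (hc : 0 < c) (hs₀ : 0 < s₀)
    (hRobin : ∀ s : ℝ, 0 < s → s < s₀ → ∀ ξ : Fin N → ℝ, c * (∑ i : Fin N, ((∑ j : Fin N,
        if j.val = i.val + 1 then (ξ j - ξ i) ^ 2 else 0) + (if i.val = 0 then ξ i ^ 2 else 0) +
        (if i.val = N - 1 then ξ i ^ 2 else 0))) ≤ ∑ x, ∑ y, ξ x * F s x y * ξ y)
    (ρ : Fin N → ℝ)
    (hρ : ∀ b : Fin N, b.val + 1 < N → Tendsto (fun s => schur s ((pinnedChain ω₂ lam β γ).bondCurrent N b)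
      (fun z => ∑ i : Fin N, (pinnedChain ω₂ lam β γ).bondCurrent N i z)) (nhdsWithin (0 : ℝ) (Set.Ioi 0))
      (nhds (ρ b)))
    (hρ0 : ∀ b : Fin N, ¬ b.val + 1 < N → ρ b = 0)
    (w₀ w₁ : ℝ)
    (hw₀ : Tendsto (fun s => schur s (fun z => z.2 (⟨0, by omega⟩ : Fin N) ^ 2)
      (fun z => ∑ i : Fin N, (pinnedChain ω₂ lam β γ).bondCurrent N i z)) (nhdsWithin (0 : ℝ) (Set.Ioi 0))
      (nhds w₀))
    (hw₁ : Tendsto (fun s => schur s (fun z => z.2 (⟨N - 1, by omega⟩ : Fin N) ^ 2)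
      (fun z => ∑ i : Fin N, (pinnedChain ω₂ lam β γ).bondCurrent N i z)) (nhdsWithin (0 : ℝ) (Set.Ioi 0))
      (nhds w₁))
    (k : ℝ) :
    (∑ b, ρ b) - (1 / c) * ((∑ b : Fin N, if b.val + 1 < N then (ρ b - k) ^ 2 else 0) +
        ((pinnedChain ω₂ lam β γ).γ * w₀ - k) ^ 2 + ((pinnedChain ω₂ lam β γ).γ * w₁ + k) ^ 2) ≤
      ∫ t in Set.Ioi (0 : ℝ), corr (fun z => ∑ i : Fin N, (pinnedChain ω₂ lam β γ).bondCurrent N i z)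
        (fun z => ∑ i : Fin N, (pinnedChain ω₂ lam β γ).bondCurrent N i z) t ∧
    ∫ t in Set.Ioi (0 : ℝ), corr (fun z => ∑ i : Fin N, (pinnedChain ω₂ lam β γ).bondCurrent N i z)
        (fun z => ∑ i : Fin N, (pinnedChain ω₂ lam β γ).bondCurrent N i z) t ≤ ∑ b, ρ b := by
  set J : PhaseSpace N → ℝ := fun z => ∑ i : Fin N, (pinnedChain ω₂ lam β γ).bondCurrent N i z with hJ
  set j : Fin N → PhaseSpace N → ℝ := (pinnedChain ω₂ lam β γ).bondCurrent N with hj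
  -- every bond response converges (the missing last bond is identically zero)
  have hρ' : ∀ b : Fin N, Tendsto (fun s => schur s (j b) J) (nhdsWithin (0 : ℝ) (Set.Ioi 0))
      (nhds (ρ b)) := by
    intro b
    by_cases hb : b.val + 1 < N
    · exact hρ b hb
    · have h0 : ∀ s, schur s (j b) J = 0 := by
        intro s
        rw [hschur, pkg_j_last hcorr hlap s b hb, zero_sub, neg_eq_zero]
        refine Finset.sum_eq_zero fun x _ => Finset.sum_eq_zero fun y _ => ?_
        rw [pkg_j_last hcorr hlap s b hb, zero_mul, zero_mul]
      rw [show (fun s => schur s (j b) J) = fun _ => 0 from funext h0, hρ0 b hb]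
      exact tendsto_const_nhds
  -- the upper and lower bounds converge
  have hUB : Tendsto (fun s => ∑ b, schur s (j b) J) (nhdsWithin (0 : ℝ) (Set.Ioi 0))
      (nhds (∑ b, ρ b)) := tendsto_finsetSum _ fun b _ => hρ' b
  have hLB : Tendsto (fun s => (∑ b, schur s (j b) J) - (1 / c) *
      ((∑ b : Fin N, if b.val + 1 < N then (schur s (j b) J - k) ^ 2 else 0) +
        ((pinnedChain ω₂ lam β γ).γ * schur s (fun z => z.2 (⟨0, by omega⟩ : Fin N) ^ 2) J - k) ^ 2 +
        ((pinnedChain ω₂ lam β γ).γ * schur s (fun z => z.2 (⟨N - 1, by omega⟩ : Fin N) ^ 2) J + k) ^ 2))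
      (nhdsWithin (0 : ℝ) (Set.Ioi 0))
      (nhds ((∑ b, ρ b) - (1 / c) * ((∑ b : Fin N, if b.val + 1 < N then (ρ b - k) ^ 2 else 0) +
        ((pinnedChain ω₂ lam β γ).γ * w₀ - k) ^ 2 + ((pinnedChain ω₂ lam β γ).γ * w₁ + k) ^ 2))) := by
    refine hUB.sub (Tendsto.const_mul _ (Tendsto.add (Tendsto.add ?_ ?_) ?_))
    · refine tendsto_finsetSum _ fun b _ => ?_
      by_cases hb : b.val + 1 < N
      · simp only [if_pos hb]
        exact ((hρ' b).sub_const k).pow 2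
      · simp only [if_neg hb]
        exact tendsto_const_nhds
    · exact ((hw₀.const_mul _).sub_const k).pow 2
    · exact ((hw₁.const_mul _).add_const k).pow 2
  have hlapJJ := tendsto_lap_totalCurrent hAdm hlap hFI hω hl hβ hT (corr := corr)
  -- the sandwich holds for 0 < s < s₀
  have hsand : ∀ᶠ s in nhdsWithin (0 : ℝ) (Set.Ioi 0),
      (∑ b, schur s (j b) J) - (1 / c) *
        ((∑ b : Fin N, if b.val + 1 < N then (schur s (j b) J - k) ^ 2 else 0) +
          ((pinnedChain ω₂ lam β γ).γ * schur s (fun z => z.2 (⟨0, by omega⟩ : Fin N) ^ 2) J - k) ^ 2 +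
          ((pinnedChain ω₂ lam β γ).γ * schur s (fun z => z.2 (⟨N - 1, by omega⟩ : Fin N) ^ 2) J + k) ^ 2)
        ≤ lap s J J ∧ lap s J J ≤ ∑ b, schur s (j b) J := by
    filter_upwards [Ioo_mem_nhdsGT hs₀] with s hs
    exact fixedN_sandwich hAdm hcorr hlap hcov he hFI hGSE hPS hω hl hβ hγ hT hN hs.1 (G s) (hG s)
      (schur s) (hschur s) (F s) (hF s) (hGp s hs.1) hCp hc (hRobin s hs.1 hs.2) k
  constructor
  · exact le_of_tendsto_of_tendsto hLB hlapJJ (hsand.mono fun s hs => hs.1)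
  · exact le_of_tendsto_of_tendsto hlapJJ hUB (hsand.mono fun s hs => hs.2)

end Limits

/-! ### Bookkeeping for `N → ∞` -/

/-- A linear sandwich gives the Cesàro-type limit: if for every `ε > 0` there is `K` with
`|I_N − (N−1)k| ≤ (N−1)ε + K` for all `N ≥ 2`, then `I_N/(N−1) → k`. -/
theorem tendsto_div_of_linear_bound (I : ℕ → ℝ) (k : ℝ)
    (h : ∀ ε : ℝ, 0 < ε → ∃ K : ℝ, ∀ N : ℕ, 2 ≤ N → |I N - ((N : ℝ) - 1) * k| ≤ ((N : ℝ) - 1) * ε + K) :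
    Tendsto (fun N : ℕ => I N / ((N : ℝ) - 1)) atTop (nhds k) := by
  rw [Metric.tendsto_atTop]
  intro ε hε
  obtain ⟨K, hK⟩ := h (ε / 2) (half_pos hε)
  obtain ⟨N₀, hN₀⟩ := exists_nat_gt (2 * |K| / ε + 2)
  refine ⟨N₀, fun N hN => ?_⟩
  have hN2 : (2 : ℝ) ≤ N := by
    have : (N₀ : ℝ) ≤ N := by exact_mod_cast hN
    have h0 : (0 : ℝ) ≤ 2 * |K| / ε := by positivity
    linarith
  have hN2' : 2 ≤ N := by exact_mod_cast hN2
  have hpos : (0 : ℝ) < (N : ℝ) - 1 := by linarith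
  have hb := hK N hN2'
  rw [Real.dist_eq]
  have hrepr : I N / ((N : ℝ) - 1) - k = (I N - ((N : ℝ) - 1) * k) / ((N : ℝ) - 1) := by
    field_simp
  rw [hrepr, abs_div, abs_of_pos hpos, div_lt_iff₀ hpos]
  have h1 : (N : ℝ) - 1 > 2 * |K| / ε := by
    have : (N₀ : ℝ) ≤ N := by exact_mod_cast hN
    linarith
  have h2 : |K| < ((N : ℝ) - 1) * (ε / 2) := by
    rw [gt_iff_lt, div_lt_iff₀ hε] at h1
    linarith
  calc |I N - ((N : ℝ) - 1) * k| ≤ ((N : ℝ) - 1) * (ε / 2) + K := hb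
    _ ≤ ((N : ℝ) - 1) * (ε / 2) + |K| := by linarith [le_abs_self K]
    _ < ((N : ℝ) - 1) * (ε / 2) + ((N : ℝ) - 1) * (ε / 2) := by linarith
    _ = ε * ((N : ℝ) - 1) := by ring

/-- At most `2R + 1` bonds of the `N`-chain are within distance `R` of an end. -/
theorem card_nonbulk_le (N R : ℕ) :
    ((Finset.univ.filter fun b : Fin N => ¬ (R ≤ b.val ∧ b.val + 2 + R ≤ N)).card : ℝ) ≤ 2 * R + 1 := by
  have h : (Finset.univ.filter fun b : Fin N => ¬ (R ≤ b.val ∧ b.val + 2 + R ≤ N)).card ≤ 2 * R + 1 := by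
    calc (Finset.univ.filter fun b : Fin N => ¬ (R ≤ b.val ∧ b.val + 2 + R ≤ N)).card
        ≤ ((Finset.range R ∪ Finset.Ico (N - 1 - R) N).image (fun i => (i : ℕ))).card := by
          refine le_trans ?_ (le_of_eq rfl)
          rw [Finset.image_id']
          refine Finset.card_le_card_of_injOn (fun b => b.val) (fun b hb => ?_) ?_
          · simp only [Finset.coe_filter, Finset.mem_univ, true_and, Set.mem_setOf_eq] at hb
            simp only [Finset.coe_union, Finset.coe_range, Finset.coe_Ico, Set.mem_union, Set.mem_Iio,
              Set.mem_Ico]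
            have := b.isLt
            omega
          · intro a _ b _ hab
            exact Fin.ext hab
      _ ≤ (Finset.range R).card + (Finset.Ico (N - 1 - R) N).card := by
          rw [Finset.image_id']
          exact Finset.card_union_le _ _
      _ ≤ R + (R + 1) := by
          rw [Finset.card_range, Nat.card_Ico]
          omega
      _ = 2 * R + 1 := by ring
  exact_mod_cast h

/-- Summing a bulk/contact dichotomy: if `|u_b| ≤ ε` on bulk bonds and `|u_b| ≤ M` on the at most
`2R+1` others (`M ≥ 0`), then `Σ_b |u_b| ≤ N ε + (2R+1) M`. -/
theorem sum_abs_le_of_bulk {N : ℕ} (R : ℕ) (u : Fin N → ℝ) {ε M : ℝ} (hε : 0 ≤ ε) (hM : 0 ≤ M)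
    (hbulk : ∀ b : Fin N, R ≤ b.val → b.val + 2 + R ≤ N → |u b| ≤ ε)
    (hall : ∀ b : Fin N, |u b| ≤ M) :
    ∑ b, |u b| ≤ N * ε + (2 * R + 1) * M := by
  classical
  have hpt : ∀ b : Fin N, |u b| ≤ ε + (if ¬ (R ≤ b.val ∧ b.val + 2 + R ≤ N) then M else 0) := by
    intro b
    by_cases h : R ≤ b.val ∧ b.val + 2 + R ≤ N
    · rw [if_neg (not_not.mpr h)]
      linarith [hbulk b h.1 h.2]
    · rw [if_pos h]
      linarith [hall b]
  calc ∑ b, |u b| ≤ ∑ b : Fin N, (ε + (if ¬ (R ≤ b.val ∧ b.val + 2 + R ≤ N) then M else 0)) :=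
        Finset.sum_le_sum fun b _ => hpt b
    _ = N * ε + ((Finset.univ.filter fun b : Fin N => ¬ (R ≤ b.val ∧ b.val + 2 + R ≤ N)).card : ℝ) * M := by
        rw [Finset.sum_add_distrib, Finset.sum_const, Finset.card_univ, Fintype.card_fin, nsmul_eq_mul,
          Finset.sum_ite, Finset.sum_const, Finset.sum_const_zero, add_zero, nsmul_eq_mul]
    _ ≤ N * ε + (2 * R + 1) * M := by
        have := card_nonbulk_le N R
        nlinarith

end Summit.AtomisticToContinuum.FouriersLaw.Theorems.HonestZwanzig.NetworkReduction
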